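import Mathlib
import HarnessLib
import Summits.HubbardSuperconductivity.HubbardSuperconductivity.Theorems.KLProgrammeC4aTwoNodeControl
import Summits.HubbardSuperconductivity.HubbardSuperconductivity.Theorems.KLProgrammeC4aPartnerBandOffsetRow

/-!
# Route `KLProgramme` — crux C4a, S3 brick (B4, DIRECT SHEET): BAND-DISTANCE CONTROL of the co-moving jets of the pp partner band near TANGENCY,
# assembled — two-node control at the loop's Fermi level + the level row (`e → 0`) + the offset row (`ρ → 0`), every order `m ≤ 4`

Cell `gate-hubbard-kl`, seat hubbard-kl-k3c3-p3 (g25; row «implicit-function / monotonicity route for μ(n)»).  Located brick «(B4)-DIRECT-COUNT» (memo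
HOME/hubbard-kl-k3c3-p3/B4-DIRECT-COUNT.md §1), the by-name form of the KEY LEMMA near the tangency configuration for the (C)-closer lane hubbard-kl-c4a-1 (stub (C)
`stub_twoLeg_curvature` of `KLRegimeEngineV17F2`, stmt-HubbardSuperconductivity-20437; C4A-PLAN §24.4–§24.6 (B4)).

With `ē(e,φ;ρ,ϑ,ψ) := e_K(Φ(0,ψ) + Φ(ρ,ϑ+ψ) − Φ(e,φ+ψ))` (loop level `e`, loop angle `φ`, partner-leg offset `ρ`, pair angle `ϑ ≠ 0`, base angle `ψ`) and its base-angle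
jets `∂ᵐ_ψ|_θ ē`, on a loop-angle window `[a′,b′] ∋ 0, ϑ` carrying the curvature floor `2c ≤ ∂²_φ ē(0,·;0,ϑ,θ)` and the mixed-jet ceiling `|∂²_φ ∂ᵐ_ψ|_θ ē(0,·;0,ϑ)| ≤ M`
(rows, hypotheses), and with the radial rows `RRᵉ`, `RRᵖ` of the loop level and of the offset up to order `m` (in the tree for `m ≤ 3`):

  **`abs_iteratedDeriv_partnerBand_pp_base_le_band_distance`**:
  `|∂ᵐ_ψ|_θ ē(e,φ;ρ,ϑ)| ≤ (M/2c)·|ē(e,φ;ρ,ϑ,θ)| + ((M/2c)·𝒦R₀ᵉ + (m+1)!·𝒦·Rᵉ·Dₑᵐ)·|e| + ((M/2c)·𝒦R₀ᵖ + (m+1)!·𝒦·Rᵖ·Dᵨᵐ)·|ρ|`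

— the anisotropy defect of every order is bounded by the THREE BAND DISTANCES `|ē|, |e|, |ρ|`, uniformly in the crossing separation `|ϑ|` (the small factor that
`…C4aEnvelopePreservation` consumes).  Chain: `ē(e,·;ρ) →[offset row, …C4aPartnerBandOffsetRow] ē(e,·;0) →[level row, …TangencyDefectSharp] ē(0,·;0) →[two-node control,
…C4aTwoNodeControl]`.  Binder shape = `…TangencyDefectSharp` (`hA hA20 hd hr hlo hhi hA₃ hA₄ hA₅ hA₆`).  Pure bookkeeping on landed objects; the curvature floor and the
mixed-jet ceiling are hypotheses (rows); nothing about the model's sizes; nothing asserts (C), K3 or superconductivity.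
References: FST II CPAM 51 (1998) §3; BGM 2006 §2.4 Lemma 2.1 [cite: BenfattoGiulianiMastropietro2006].
-/

noncomputable section

namespace Summit.HubbardSuperconductivity.HubbardSuperconductivity.Theorems.C4a

set_option linter.dupNamespace false -- summit = problem name (single-conjunct summit), D-0017

open Real Set Filter
open scoped Topology
open Literature.MathematicalPhysics.QuantumLattice Literature.MathematicalPhysics.QuantumLattice.BandSectorCounting Literature.Probability.LatticeModels
open Summit.HubbardSuperconductivity.HubbardSuperconductivity.Theorems.KLRegimeSplit
open Summit.HubbardSuperconductivity.HubbardSuperconductivity.Theorems.DispersionFlow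
open Summit.HubbardSuperconductivity.HubbardSuperconductivity.Theorems.PerturbedFermiCurve

section Sizes

variable {K : TrigPolyC4v} {A : ℝ} (hA : ∀ p : Momentum, ∀ j ≤ 2, ‖iteratedFDeriv ℝ j (frameShift K) p‖ ≤ A) (hA20 : A ≤ 1 / 20)
  (hd : klCurveD ≤ (bandBounds (show (-4 : ℝ) < -1.1 by norm_num) (show (-1.1 : ℝ) ≤ -0.1 by norm_num)
    (show (-0.1 : ℝ) < 0 by norm_num)).Dtmin - 2 * A)
  {μ r : ℝ} (hr : 0 < r) (hlo : (-1.1 : ℝ) < μ - r - A) (hhi : μ + r + A < -0.1)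
  {A₃ A₄ A₅ A₆ : ℝ} (hA₃ : ∀ p : Momentum, ‖iteratedFDeriv ℝ 3 (frameShift K) p‖ ≤ A₃)
  (hA₄ : ∀ p : Momentum, ‖iteratedFDeriv ℝ 4 (frameShift K) p‖ ≤ A₄)
  (hA₅ : ∀ p : Momentum, ‖iteratedFDeriv ℝ 5 (frameShift K) p‖ ≤ A₅)
  (hA₆ : ∀ p : Momentum, ‖iteratedFDeriv ℝ 6 (frameShift K) p‖ ≤ A₆)
include hA hA20 hd hr hlo hhi hA₃ hA₄ hA₅ hA₆

/-- **The level row in base-angle form** (`…TangencyDefectSharp.abs_iteratedDeriv_partnerBand_pp_sub_level_le_sharp` through the translation bridge):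
`|∂ᵏ_ψ|_θ ē(e,φ;ρ,ϑ) − ∂ᵏ_ψ|_θ ē(0,φ;ρ,ϑ)| ≤ |e|·(k+1)!·𝒦·R·Dᵏ`. -/
theorem abs_iteratedDeriv_partnerBand_pp_base_sub_level_le {k : ℕ} (hk : k ≤ 4) {𝒦 : ℝ}
    (hK : ∀ i, 1 ≤ i → i ≤ k + 1 → ∀ p : Momentum, ‖iteratedFDeriv ℝ i (frameLevel μ K) p‖ ≤ 𝒦)
    {ρ : ℝ} (hρ : |ρ| < r) {e : ℝ} (he : |e| < r) {RR : ℕ → ℝ}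
    (hRR : ∀ i, i ≤ k → ∀ s, ‖iteratedDeriv i (levelPoint μ K e) s - iteratedDeriv i (levelPoint μ K 0) s‖ ≤ RR i * |e|)
    {D R : ℝ} (hD0 : 0 ≤ D) (hR0 : 0 ≤ R) (hDrow : ∀ j, 1 ≤ j → j ≤ k → 3 * msD6 A₃ A₄ A₅ A₆ j + |e| * RR j ≤ D ^ j)
    (hRrow : ∀ j, j ≤ k → RR j ≤ R * D ^ j) (ϑ θ φ : ℝ) :
    |iteratedDeriv k (fun ψ : ℝ => frameLevel μ K (levelPoint μ K 0 ψ + levelPoint μ K ρ (ϑ + ψ) - levelPoint μ K e (φ + ψ))) θ -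
      iteratedDeriv k (fun ψ : ℝ => frameLevel μ K (levelPoint μ K 0 ψ + levelPoint μ K ρ (ϑ + ψ) - levelPoint μ K 0 (φ + ψ))) θ| ≤
      |e| * ((k + 1).factorial * 𝒦 * R * D ^ k) := by
  rw [iteratedDeriv_partnerBand_pp_base_eq μ K ρ ϑ e φ θ k, iteratedDeriv_partnerBand_pp_base_eq μ K ρ ϑ 0 φ θ k]
  exact abs_iteratedDeriv_partnerBand_pp_sub_level_le_sharp hA hA20 hd hr hlo hhi hA₃ hA₄ hA₅ hA₆ hk hK hρ he hRR hD0 hR0 hDrow hRrow ϑ θ φ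

/-- **BAND-DISTANCE CONTROL OF THE CO-MOVING JETS OF THE pp PARTNER BAND NEAR TANGENCY (every order `m ≤ 4`).**  See the module docstring; the two rows
at order `0` give the value displacements, the two rows at order `m` the jet displacements, and `…C4aTwoNodeControl` the control at `e = ρ = 0`. -/
theorem abs_iteratedDeriv_partnerBand_pp_base_le_band_distance {m : ℕ} (hm : m ≤ 4) {ϑ : ℝ} (hϑ : ϑ ≠ 0) (θ : ℝ) {a' b' : ℝ} (hab : a' < b')
    (ha0 : (0 : ℝ) ∈ Icc a' b') (hϑab : ϑ ∈ Icc a' b') {c M : ℝ} (hc0 : 0 < c)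
    (hc : ∀ x ∈ Icc a' b', 2 * c ≤ iteratedDeriv 2
      (fun φ : ℝ => frameLevel μ K (levelPoint μ K 0 θ + levelPoint μ K 0 (ϑ + θ) - levelPoint μ K 0 (φ + θ))) x)
    (hM : ∀ x ∈ Icc a' b', |iteratedDeriv 2 (fun φ : ℝ =>
      iteratedDeriv m (fun ψ : ℝ => frameLevel μ K (levelPoint μ K 0 ψ + levelPoint μ K 0 (ϑ + ψ) - levelPoint μ K 0 (φ + ψ))) θ) x| ≤ M)
    {𝒦 : ℝ} (hK : ∀ i, 1 ≤ i → i ≤ m + 1 → ∀ p : Momentum, ‖iteratedFDeriv ℝ i (frameLevel μ K) p‖ ≤ 𝒦)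
    {ρ : ℝ} (hρ : |ρ| < r) {e : ℝ} (he : |e| < r) {RRe RRp : ℕ → ℝ}
    (hRRe : ∀ i, i ≤ m → ∀ s, ‖iteratedDeriv i (levelPoint μ K e) s - iteratedDeriv i (levelPoint μ K 0) s‖ ≤ RRe i * |e|)
    (hRRp : ∀ i, i ≤ m → ∀ s, ‖iteratedDeriv i (levelPoint μ K ρ) s - iteratedDeriv i (levelPoint μ K 0) s‖ ≤ RRp i * |ρ|)
    {De Re Dp Rp : ℝ} (hDe : 0 ≤ De) (hRe : 0 ≤ Re) (hDp : 0 ≤ Dp) (hRp : 0 ≤ Rp)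
    (hDerow : ∀ j, 1 ≤ j → j ≤ m → 3 * msD6 A₃ A₄ A₅ A₆ j + |e| * RRe j ≤ De ^ j) (hRerow : ∀ j, j ≤ m → RRe j ≤ Re * De ^ j)
    (hDprow : ∀ j, 1 ≤ j → j ≤ m → 3 * msD6 A₃ A₄ A₅ A₆ j + |ρ| * RRp j ≤ Dp ^ j) (hRprow : ∀ j, j ≤ m → RRp j ≤ Rp * Dp ^ j)
    {φ : ℝ} (hφ : φ ∈ Icc a' b') :
    |iteratedDeriv m (fun ψ : ℝ => frameLevel μ K (levelPoint μ K 0 ψ + levelPoint μ K ρ (ϑ + ψ) - levelPoint μ K e (φ + ψ))) θ| ≤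
      M / (2 * c) * |frameLevel μ K (levelPoint μ K 0 θ + levelPoint μ K ρ (ϑ + θ) - levelPoint μ K e (φ + θ))| +
        (M / (2 * c) * (𝒦 * Re) + (m + 1).factorial * 𝒦 * Re * De ^ m) * |e| +
        (M / (2 * c) * (𝒦 * Rp) + (m + 1).factorial * 𝒦 * Rp * Dp ^ m) * |ρ| := by
  set B₀ := bandBounds (show (-4 : ℝ) < -1.1 by norm_num) (show (-1.1 : ℝ) ≤ -0.1 by norm_num) (show (-0.1 : ℝ) < 0 by norm_num) with hB₀
  have hADt : 2 * A < B₀.Dtmin := by have := klCurveD_pos; linarith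
  have h0 : |(0 : ℝ)| < r := by simpa using hr
  have hM0 : 0 ≤ M := (abs_nonneg _).trans (hM 0 ha0)
  have hq : 0 ≤ M / (2 * c) := by positivity
  -- two-node control at `e = ρ = 0`
  have h2 := abs_iteratedDeriv_partnerBand_pp_base_le_mul_abs B₀ hA hADt hr hlo hhi hϑ θ m hab ha0 hϑab hc0 hc hM hφ
  -- rows at order `m` and `0`
  have hK0 : ∀ i, 1 ≤ i → i ≤ 0 + 1 → ∀ p : Momentum, ‖iteratedFDeriv ℝ i (frameLevel μ K) p‖ ≤ 𝒦 := fun i hi1 hi p => hK i hi1 (by omega) p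
  have hem := abs_iteratedDeriv_partnerBand_pp_base_sub_level_le hA hA20 hd hr hlo hhi hA₃ hA₄ hA₅ hA₆ hm hK h0 he hRRe hDe hRe hDerow hRerow ϑ θ φ
  have he0 := abs_iteratedDeriv_partnerBand_pp_base_sub_level_le hA hA20 hd hr hlo hhi hA₃ hA₄ hA₅ hA₆ (k := 0) (by norm_num) hK0 h0 he
    (RR := RRe) (fun i hi s => hRRe i (by omega) s) hDe hRe (fun j hj1 hj => by omega) (fun j hj => hRerow j (by omega)) ϑ θ φ
  have hpm := abs_iteratedDeriv_partnerBand_pp_base_sub_offset_le hA hA20 hd hr hlo hhi hA₃ hA₄ hA₅ hA₆ hm hK hρ he hRRp hDp hRp hDprow hRprow ϑ θ φ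
  have hp0 := abs_iteratedDeriv_partnerBand_pp_base_sub_offset_le hA hA20 hd hr hlo hhi hA₃ hA₄ hA₅ hA₆ (k := 0) (by norm_num) hK0 hρ he
    (RR := RRp) (fun i hi s => hRRp i (by omega) s) hDp hRp (fun j hj1 hj => by omega) (fun j hj => hRprow j (by omega)) ϑ θ φ
  simp only [iteratedDeriv_zero, Nat.factorial, Nat.cast_one, pow_zero, mul_one] at he0 hp0
  -- bookkeeping: |h(e,ρ)| ≤ |h(0,0)| + ℓm^e|e| + ℓm^ρ|ρ| ≤ q|f(0,0)| + … ≤ q(|f(e,ρ)| + ℓ0^e|e| + ℓ0^ρ|ρ|) + …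
  have habs1 := abs_sub_abs_le_abs_sub
    (iteratedDeriv m (fun ψ : ℝ => frameLevel μ K (levelPoint μ K 0 ψ + levelPoint μ K ρ (ϑ + ψ) - levelPoint μ K e (φ + ψ))) θ)
    (iteratedDeriv m (fun ψ : ℝ => frameLevel μ K (levelPoint μ K 0 ψ + levelPoint μ K 0 (ϑ + ψ) - levelPoint μ K e (φ + ψ))) θ)
  have habs2 := abs_sub_abs_le_abs_sub
    (iteratedDeriv m (fun ψ : ℝ => frameLevel μ K (levelPoint μ K 0 ψ + levelPoint μ K 0 (ϑ + ψ) - levelPoint μ K e (φ + ψ))) θ)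
    (iteratedDeriv m (fun ψ : ℝ => frameLevel μ K (levelPoint μ K 0 ψ + levelPoint μ K 0 (ϑ + ψ) - levelPoint μ K 0 (φ + ψ))) θ)
  have habs3 := abs_sub_abs_le_abs_sub
    (frameLevel μ K (levelPoint μ K 0 θ + levelPoint μ K 0 (ϑ + θ) - levelPoint μ K 0 (φ + θ)))
    (frameLevel μ K (levelPoint μ K 0 θ + levelPoint μ K 0 (ϑ + θ) - levelPoint μ K e (φ + θ)))
  have habs4 := abs_sub_abs_le_abs_sub
    (frameLevel μ K (levelPoint μ K 0 θ + levelPoint μ K 0 (ϑ + θ) - levelPoint μ K e (φ + θ)))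
    (frameLevel μ K (levelPoint μ K 0 θ + levelPoint μ K ρ (ϑ + θ) - levelPoint μ K e (φ + θ)))
  rw [abs_sub_comm] at habs3 habs4
  nlinarith [mul_le_mul_of_nonneg_left (le_trans habs3 he0) hq, mul_le_mul_of_nonneg_left (le_trans habs4 hp0) hq,
    abs_nonneg e, abs_nonneg ρ, mul_nonneg hq (abs_nonneg e), mul_nonneg hq (abs_nonneg ρ)]

end Sizes

end Summit.HubbardSuperconductivity.HubbardSuperconductivity.Theorems.C4a

end
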